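import Summits.AtomisticToContinuum.FouriersLaw.Theorems.LatticeLandauDampingAbelThermodynamicLimitUniformAnchoredCorrelationTailsSiteTails

/-!
# The weighted position box of the open pinned chain holds off a small exceptional set, uniformly in `N` (light cone of (C′))

Helper (`--supports stmt-AtomisticToContinuum-14013`) for the line `series-law-at-every-laplace-frequency`
(SketchIdeator2) of the crux `LatticeLandauDamping.AbelThermodynamicLimit`, stub (C′)
`stub_uniformAnchoredCorrelationTails`. Registered sub-goal `pinnedChain_weightedBox_exceptionalSet`.

Under the stationary law `π = μ_T ⊗ W` of the constructed Langevin flow `Φ_r(x, Bω) = solMap N T T r x (pairPath ω)`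
of the pinned chain with both baths at `T > 0`, for the weight `g(n) = √(1 + n)`, a site `i₀`, a scale `ρ ≥ 1` and a
horizon `τ > 0`, the exceptional set

  `E = {∃ j j', |j' - j| ≤ 1 ∧ (ρ² g(|j - i₀|)/4 < q_{j'}(0)² ∨ ρ² g(|j - i₀|)/(4τ) < ∫₀^τ p_{j'}(Φ_r)² dr)}`

is measurable, `π(E) ≤ K ρ^{-32}` with `K = K(ω₂, lam, β, T, τ)` INDEPENDENT of `N` and `i₀` (union bound over the
`≤ 3N` pairs `(j, j')`, the `N`-uniform one-site tails `pinnedChain_stationary_site_tails` with the sixteenth power,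
`g^{16} = (1+n)^8 ≥ (1+n)²` and the lattice sum `Σ_j (1 + |j - i₀|)^{-2} ≤ 4`), and OFF `E` the kinematic bound
`q(s)² ≤ 2q(0)² + 2τ∫₀^τ p²` (`pinnedChain_solMap_position_sq_le`) gives the WEIGHTED BOX
`q_{j'}(Φ_s)² ≤ ρ² g(|j - i₀|)` for all `s ∈ [0, τ]` and all `|j' - j| ≤ 1` — the hypothesis of the pathwise
weighted propagation bound `chainFlow_momentumFlip_propagation_weighted`. Folklore; no definitions (the set is
produced existentially in the registered statement).
-/

noncomputable section

open MeasureTheory ProbabilityTheory Set Filter Topology Finset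
open scoped NNReal ENNReal BigOperators

namespace Summit.AtomisticToContinuum.FouriersLaw.Theorems.AbelThermodynamicLimit.SeriesLawAtEveryLaplaceFrequency

open Literature.MathematicalPhysics.KineticTheory Literature.MathematicalPhysics.KineticTheory.HeatConduction
open Literature.Probability.Process OscillatorChain
open Summit.AtomisticToContinuum.FouriersLaw.Theorems.NonBallistic

namespace BoxTail

/-- At most three sites are within distance one of a given site. [folklore] -/
theorem card_near_le_three {N : ℕ} (j : Fin N) :
    (Finset.univ.filter fun j' : Fin N => (((j' : ℕ) : ℤ) - j).natAbs ≤ 1).card ≤ 3 := by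
  have h := Finset.card_le_card_of_injOn (s := Finset.univ.filter fun j' : Fin N => (((j' : ℕ) : ℤ) - j).natAbs ≤ 1)
    (t := Finset.range 3) (fun j' : Fin N => j'.val + 1 - j.val) ?_ ?_
  · simpa using h
  · intro j' hj'
    simp only [Finset.coe_filter, Finset.mem_univ, true_and, Set.mem_setOf_eq] at hj'
    simp only [Finset.coe_range, Set.mem_Iio]
    omega
  · intro a ha b hb hab
    simp only [Finset.coe_filter, Finset.mem_univ, true_and, Set.mem_setOf_eq] at ha hb
    exact Fin.ext (by simp only at hab; omega)

/-- `θ^{16} = ρ^{32} (1+n)^8 ≥ ρ^{32}(1+n)²` for `θ = ρ² √(1+n)`, `ρ ≥ 1`: the reciprocal bound used in the union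
bound. [folklore] -/
theorem inv_theta_pow_le {ρ : ℝ} (hρ : 1 ≤ ρ) (n : ℕ) {c : ℝ} (hc : 0 ≤ c) :
    c / (ρ ^ 2 * Real.sqrt (1 + (n : ℝ))) ^ 16 ≤ c / ρ ^ 32 * (1 / (1 + (n : ℝ)) ^ 2) := by
  have hn : (0 : ℝ) ≤ n := n.cast_nonneg
  have hρ0 : 0 < ρ := lt_of_lt_of_le one_pos hρ
  rw [mul_pow, weight_pow_sixteen, ← pow_mul, show 2 * 16 = 32 by norm_num, div_mul_div_comm, mul_one]
  refine div_le_div_of_nonneg_left hc (by positivity) ?_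
  refine mul_le_mul_of_nonneg_left ?_ (by positivity)
  exact pow_le_pow_right₀ (by linarith) (by norm_num)

section ExcSet

variable {ω₂ lam β γ : ℝ} (hω : 0 < ω₂) (hl : 0 ≤ lam) (hβ : 0 ≤ β) (hγ : 0 ≤ γ) {T : ℝ} (hT : 0 < T)
  {N : ℕ} (i₀ : Fin N) {ρ τ : ℝ}

include hω hl hβ hγ in
/-- The exceptional set is measurable. [folklore] -/
theorem measurableSet_exc :
    MeasurableSet {q : PhaseSpace N × WienerPair | ∃ j j' : Fin N, (((j' : ℕ) : ℤ) - j).natAbs ≤ 1 ∧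
      (ρ ^ 2 * Real.sqrt (1 + ((((j : ℕ) : ℤ) - i₀).natAbs : ℝ)) / 4 < q.1.1 j' ^ 2 ∨
        ρ ^ 2 * Real.sqrt (1 + ((((j : ℕ) : ℤ) - i₀).natAbs : ℝ)) / (4 * τ) <
          ∫ r in (0:ℝ)..τ, ((pinnedChain ω₂ lam β γ).solMap N T T r q.1 (pairPath q.2)).2 j' ^ 2)} := by
  have h : {q : PhaseSpace N × WienerPair | ∃ j j' : Fin N, (((j' : ℕ) : ℤ) - j).natAbs ≤ 1 ∧
      (ρ ^ 2 * Real.sqrt (1 + ((((j : ℕ) : ℤ) - i₀).natAbs : ℝ)) / 4 < q.1.1 j' ^ 2 ∨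
        ρ ^ 2 * Real.sqrt (1 + ((((j : ℕ) : ℤ) - i₀).natAbs : ℝ)) / (4 * τ) <
          ∫ r in (0:ℝ)..τ, ((pinnedChain ω₂ lam β γ).solMap N T T r q.1 (pairPath q.2)).2 j' ^ 2)} =
      ⋃ j : Fin N, ⋃ j' : Fin N, {q | (((j' : ℕ) : ℤ) - j).natAbs ≤ 1 ∧
        (ρ ^ 2 * Real.sqrt (1 + ((((j : ℕ) : ℤ) - i₀).natAbs : ℝ)) / 4 < q.1.1 j' ^ 2 ∨
          ρ ^ 2 * Real.sqrt (1 + ((((j : ℕ) : ℤ) - i₀).natAbs : ℝ)) / (4 * τ) <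
            ∫ r in (0:ℝ)..τ, ((pinnedChain ω₂ lam β γ).solMap N T T r q.1 (pairPath q.2)).2 j' ^ 2)} := by
    ext q; simp
  rw [h]
  refine MeasurableSet.iUnion fun j => MeasurableSet.iUnion fun j' => ?_
  have h1 : Measurable fun q : PhaseSpace N × WienerPair => q.1.1 j' ^ 2 :=
    (((measurable_pi_apply j').comp measurable_fst).comp measurable_fst).pow_const 2
  have h2 := pinnedChain_measurable_timeIntegral_momentum_pow hω hl hβ hγ N T T τ j' 2
  rw [Set.setOf_and, Set.setOf_or]
  exact (MeasurableSet.const _).inter ((measurableSet_lt measurable_const h1).union (measurableSet_lt measurable_const h2))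

include hω hl hβ hγ in
/-- **Off the exceptional set the weighted box holds** on `[0, τ]` (`τ > 0`): kinematics
`q(s)² ≤ 2q(0)² + 2τ∫₀^τ p²`. [folklore] -/
theorem box_of_not_mem_exc (hτ : 0 < τ) {q : PhaseSpace N × WienerPair}
    (hq : q ∉ {q : PhaseSpace N × WienerPair | ∃ j j' : Fin N, (((j' : ℕ) : ℤ) - j).natAbs ≤ 1 ∧
      (ρ ^ 2 * Real.sqrt (1 + ((((j : ℕ) : ℤ) - i₀).natAbs : ℝ)) / 4 < q.1.1 j' ^ 2 ∨
        ρ ^ 2 * Real.sqrt (1 + ((((j : ℕ) : ℤ) - i₀).natAbs : ℝ)) / (4 * τ) <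
          ∫ r in (0:ℝ)..τ, ((pinnedChain ω₂ lam β γ).solMap N T T r q.1 (pairPath q.2)).2 j' ^ 2)}) :
    ∀ s ∈ Set.Icc (0:ℝ) τ, ∀ j j' : Fin N, (((j' : ℕ) : ℤ) - j).natAbs ≤ 1 →
      ((pinnedChain ω₂ lam β γ).solMap N T T s q.1 (pairPath q.2)).1 j' ^ 2 ≤
        ρ ^ 2 * Real.sqrt (1 + ((((j : ℕ) : ℤ) - i₀).natAbs : ℝ)) := by
  intro s hs j j' hjj'
  simp only [Set.mem_setOf_eq, not_exists, not_and, not_or, not_lt] at hq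
  obtain ⟨h1, h2⟩ := hq j j' hjj'
  have hkin := pinnedChain_solMap_position_sq_le ω₂ lam β γ hω hl hβ hγ N T T q.1 (pairPath q.2) τ s hs j'
  set θ := ρ ^ 2 * Real.sqrt (1 + ((((j : ℕ) : ℤ) - i₀).natAbs : ℝ)) with hθ
  have h2' : 2 * τ * ∫ r in (0:ℝ)..τ, ((pinnedChain ω₂ lam β γ).solMap N T T r q.1 (pairPath q.2)).2 j' ^ 2 ≤ θ / 2 := by
    calc 2 * τ * ∫ r in (0:ℝ)..τ, ((pinnedChain ω₂ lam β γ).solMap N T T r q.1 (pairPath q.2)).2 j' ^ 2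
        ≤ 2 * τ * (θ / (4 * τ)) := mul_le_mul_of_nonneg_left h2 (by positivity)
      _ = θ / 2 := by field_simp; ring
  linarith

/-- **The exceptional set is small, uniformly in `N` and `i₀`**: with the constant `C` of the one-site tails
(`pinnedChain_stationary_site_tails`), `π(E) ≤ 12 · 4^{16} C (1 + τ^{32}) / ρ^{32}`. [folklore] -/
theorem measure_exc_le (hτ : 0 < τ) (hρ : 1 ≤ ρ) {C : ℝ} (hC0 : 0 ≤ C)
    (hC : ∀ (N : ℕ) (j : Fin N) (t θ : ℝ), 0 ≤ t → 0 < θ →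
      (((pinnedChain ω₂ lam β γ).gibbsMeasure N T).prod wienerPair)
          {q : PhaseSpace N × WienerPair | θ < q.1.1 j ^ 2} ≤ ENNReal.ofReal (C / θ ^ 16) ∧
      (((pinnedChain ω₂ lam β γ).gibbsMeasure N T).prod wienerPair)
          {q : PhaseSpace N × WienerPair | θ < ∫ r in (0:ℝ)..t,
            ((pinnedChain ω₂ lam β γ).solMap N T T r q.1 (pairPath q.2)).2 j ^ 2} ≤
        ENNReal.ofReal (C * t ^ 16 / θ ^ 16)) :
    (((pinnedChain ω₂ lam β γ).gibbsMeasure N T).prod wienerPair)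
        {q : PhaseSpace N × WienerPair | ∃ j j' : Fin N, (((j' : ℕ) : ℤ) - j).natAbs ≤ 1 ∧
          (ρ ^ 2 * Real.sqrt (1 + ((((j : ℕ) : ℤ) - i₀).natAbs : ℝ)) / 4 < q.1.1 j' ^ 2 ∨
            ρ ^ 2 * Real.sqrt (1 + ((((j : ℕ) : ℤ) - i₀).natAbs : ℝ)) / (4 * τ) <
              ∫ r in (0:ℝ)..τ, ((pinnedChain ω₂ lam β γ).solMap N T T r q.1 (pairPath q.2)).2 j' ^ 2)} ≤
      ENNReal.ofReal (12 * (4 ^ 16 * C * (1 + τ ^ 32)) / ρ ^ 32) := by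
  set P := pinnedChain ω₂ lam β γ with hP
  set π := (P.gibbsMeasure N T).prod wienerPair with hπ
  set g : Fin N → ℝ := fun j => Real.sqrt (1 + ((((j : ℕ) : ℤ) - i₀).natAbs : ℝ)) with hg
  have hρ0 : 0 < ρ := lt_of_lt_of_le one_pos hρ
  have hg1 : ∀ j, 1 ≤ g j := fun j => weight_one_le _
  have hθ0 : ∀ j, 0 < ρ ^ 2 * g j := fun j => by have := hg1 j; positivity
  -- the pieces of the union
  set Ejj : Fin N → Fin N → Set (PhaseSpace N × WienerPair) := fun j j' =>
    {q | (((j' : ℕ) : ℤ) - j).natAbs ≤ 1 ∧ (ρ ^ 2 * g j / 4 < q.1.1 j' ^ 2 ∨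
      ρ ^ 2 * g j / (4 * τ) < ∫ r in (0:ℝ)..τ, (P.solMap N T T r q.1 (pairPath q.2)).2 j' ^ 2)} with hEjj
  set K₁ : ℝ := 4 ^ 16 * C * (1 + τ ^ 32) / ρ ^ 32 with hK₁
  have hK₁0 : 0 ≤ K₁ := by positivity
  set r : Fin N → Fin N → ℝ := fun j j' =>
    if (((j' : ℕ) : ℤ) - j).natAbs ≤ 1 then K₁ * (1 / (1 + ((((j : ℕ) : ℤ) - i₀).natAbs : ℝ)) ^ 2) else 0 with hr
  have hr0 : ∀ j j', 0 ≤ r j j' := fun j j' => by simp only [hr]; split_ifs <;> positivity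
  -- each piece
  have hpiece : ∀ j j', π (Ejj j j') ≤ ENNReal.ofReal (r j j') := by
    intro j j'
    by_cases hnb : (((j' : ℕ) : ℤ) - j).natAbs ≤ 1
    · have hsub : Ejj j j' ⊆ {q | ρ ^ 2 * g j / 4 < q.1.1 j' ^ 2} ∪
          {q | ρ ^ 2 * g j / (4 * τ) < ∫ r in (0:ℝ)..τ, (P.solMap N T T r q.1 (pairPath q.2)).2 j' ^ 2} := by
        intro q hq; exact hq.2
      obtain ⟨hA, -⟩ := hC N j' τ (ρ ^ 2 * g j / 4) hτ.le (by have := hθ0 j; positivity)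
      obtain ⟨-, hB⟩ := hC N j' τ (ρ ^ 2 * g j / (4 * τ)) hτ.le (by have := hθ0 j; positivity)
      have e1 : C / (ρ ^ 2 * g j / 4) ^ 16 = 4 ^ 16 * C / (ρ ^ 2 * g j) ^ 16 := by
        rw [div_pow]; field_simp
      have e2 : C * τ ^ 16 / (ρ ^ 2 * g j / (4 * τ)) ^ 16 = 4 ^ 16 * C * τ ^ 32 / (ρ ^ 2 * g j) ^ 16 := by
        rw [div_pow, mul_pow]; field_simp
      have hsum : 4 ^ 16 * C / (ρ ^ 2 * g j) ^ 16 + 4 ^ 16 * C * τ ^ 32 / (ρ ^ 2 * g j) ^ 16 ≤ r j j' := by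
        simp only [hr, if_pos hnb]
        rw [← add_div, show (4:ℝ) ^ 16 * C + 4 ^ 16 * C * τ ^ 32 = 4 ^ 16 * C * (1 + τ ^ 32) by ring]
        exact inv_theta_pow_le hρ _ (by positivity)
      calc π (Ejj j j') ≤ π ({q | ρ ^ 2 * g j / 4 < q.1.1 j' ^ 2} ∪
            {q | ρ ^ 2 * g j / (4 * τ) < ∫ r in (0:ℝ)..τ, (P.solMap N T T r q.1 (pairPath q.2)).2 j' ^ 2}) :=
            measure_mono hsub
        _ ≤ π {q | ρ ^ 2 * g j / 4 < q.1.1 j' ^ 2} +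
            π {q | ρ ^ 2 * g j / (4 * τ) < ∫ r in (0:ℝ)..τ, (P.solMap N T T r q.1 (pairPath q.2)).2 j' ^ 2} :=
            measure_union_le _ _
        _ ≤ ENNReal.ofReal (4 ^ 16 * C / (ρ ^ 2 * g j) ^ 16) + ENNReal.ofReal (4 ^ 16 * C * τ ^ 32 / (ρ ^ 2 * g j) ^ 16) := by
            rw [← e1, ← e2]; exact add_le_add hA hB
        _ = ENNReal.ofReal (4 ^ 16 * C / (ρ ^ 2 * g j) ^ 16 + 4 ^ 16 * C * τ ^ 32 / (ρ ^ 2 * g j) ^ 16) :=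
            (ENNReal.ofReal_add (by have := hθ0 j; positivity) (by have := hθ0 j; positivity)).symm
        _ ≤ ENNReal.ofReal (r j j') := ENNReal.ofReal_le_ofReal hsum
    · have he : Ejj j j' = ∅ := by
        ext q; simp only [hEjj, Set.mem_setOf_eq, Set.mem_empty_iff_false, iff_false, not_and]; exact fun h => absurd h hnb
      rw [he, measure_empty]
      exact bot_le
  -- the union bound
  have hE : {q : PhaseSpace N × WienerPair | ∃ j j' : Fin N, (((j' : ℕ) : ℤ) - j).natAbs ≤ 1 ∧
      (ρ ^ 2 * g j / 4 < q.1.1 j' ^ 2 ∨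
        ρ ^ 2 * g j / (4 * τ) < ∫ r in (0:ℝ)..τ, (P.solMap N T T r q.1 (pairPath q.2)).2 j' ^ 2)} =
      ⋃ j : Fin N, ⋃ j' : Fin N, Ejj j j' := by
    ext q; simp [hEjj]
  have hreal : ∑ j : Fin N, ∑ j' : Fin N, r j j' ≤ 12 * K₁ := by
    have hinner : ∀ j : Fin N, ∑ j' : Fin N, r j j' ≤ 3 * (K₁ * (1 / (1 + ((((j : ℕ) : ℤ) - i₀).natAbs : ℝ)) ^ 2)) := by
      intro j
      simp only [hr]
      rw [← Finset.sum_filter, Finset.sum_const, nsmul_eq_mul]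
      refine mul_le_mul_of_nonneg_right ?_ (by positivity)
      exact_mod_cast card_near_le_three j
    calc ∑ j : Fin N, ∑ j' : Fin N, r j j'
        ≤ ∑ j : Fin N, 3 * (K₁ * (1 / (1 + ((((j : ℕ) : ℤ) - i₀).natAbs : ℝ)) ^ 2)) := Finset.sum_le_sum fun j _ => hinner j
      _ = 3 * K₁ * ∑ j : Fin N, 1 / (1 + ((((j : ℕ) : ℤ) - i₀).natAbs : ℝ)) ^ 2 := by
          rw [Finset.mul_sum]; exact Finset.sum_congr rfl fun j _ => by ring
      _ ≤ 3 * K₁ * 4 := mul_le_mul_of_nonneg_left (sum_inv_sq_dist_le i₀) (by positivity)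
      _ = 12 * K₁ := by ring
  show π _ ≤ _
  rw [hE]
  calc π (⋃ j : Fin N, ⋃ j' : Fin N, Ejj j j') ≤ ∑ j : Fin N, π (⋃ j' : Fin N, Ejj j j') := measure_iUnion_fintype_le _ _
    _ ≤ ∑ j : Fin N, ∑ j' : Fin N, π (Ejj j j') := Finset.sum_le_sum fun j _ => measure_iUnion_fintype_le _ _
    _ ≤ ∑ j : Fin N, ∑ j' : Fin N, ENNReal.ofReal (r j j') :=
        Finset.sum_le_sum fun j _ => Finset.sum_le_sum fun j' _ => hpiece j j'
    _ = ENNReal.ofReal (∑ j : Fin N, ∑ j' : Fin N, r j j') := by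
        rw [ENNReal.ofReal_sum_of_nonneg fun j _ => Finset.sum_nonneg fun j' _ => hr0 j j']
        exact Finset.sum_congr rfl fun j _ => (ENNReal.ofReal_sum_of_nonneg fun j' _ => hr0 j j').symm
    _ ≤ ENNReal.ofReal (12 * K₁) := ENNReal.ofReal_le_ofReal hreal
    _ = ENNReal.ofReal (12 * (4 ^ 16 * C * (1 + τ ^ 32)) / ρ ^ 32) := by rw [hK₁]; ring_nf

end ExcSet

end BoxTail

open BoxTail in
/-- **Registered helper `pinnedChain_weightedBox_exceptionalSet`** (probabilistic input of stub (C′)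
`stub_uniformAnchoredCorrelationTails`, line `series-law-at-every-laplace-frequency`): under the stationary law
`μ_T ⊗ W` of the constructed Langevin flow of the pinned anharmonic chain with both baths at temperature `T > 0`,
for every horizon `τ > 0` there is `K = K(ω₂, lam, β, T, τ)` such that for EVERY length `N`, EVERY site `i₀` and
every scale `ρ ≥ 1` there is a measurable exceptional set of probability `≤ K/ρ^{32}` off which the WEIGHTED
POSITION BOX `q_{j'}(Φ_s(x, Bω))² ≤ ρ² √(1 + |j - i₀|)` holds for all `s ∈ [0, τ]` and all sites `|j' - j| ≤ 1`
(the hypothesis of the pathwise weighted propagation bound `chainFlow_momentumFlip_propagation_weighted`; the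
summability `Σ_j (1 + |j - i₀|)^{-2} ≤ 4` of the sixteenth-power one-site tails makes `K` independent of `N`).
[folklore] -/
theorem pinnedChain_weightedBox_exceptionalSet :
    ∀ ω₂ lam β γ : ℝ, 0 < ω₂ → 0 ≤ lam → 0 ≤ β → 0 ≤ γ → ∀ T : ℝ, 0 < T → ∀ τ : ℝ, 0 < τ →
      ∃ K : ℝ, 0 ≤ K ∧ ∀ (N : ℕ) (i₀ : Fin N) (ρ : ℝ), 1 ≤ ρ →
        ∃ E : Set (Literature.MathematicalPhysics.KineticTheory.HeatConduction.PhaseSpace N ×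
            Literature.Probability.Process.WienerPair), MeasurableSet E ∧
          (((Literature.MathematicalPhysics.KineticTheory.HeatConduction.pinnedChain ω₂ lam β γ).gibbsMeasure N T).prod
              Literature.Probability.Process.wienerPair) E ≤ ENNReal.ofReal (K / ρ ^ 32) ∧
          ∀ q ∉ E, ∀ s ∈ Set.Icc (0:ℝ) τ, ∀ j j' : Fin N, ((j' : ℤ) - j).natAbs ≤ 1 →
            ((Literature.MathematicalPhysics.KineticTheory.HeatConduction.pinnedChain ω₂ lam β γ).solMap N T T s q.1
                (Literature.Probability.Process.pairPath q.2)).1 j' ^ 2 ≤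
              ρ ^ 2 * Real.sqrt (1 + (((j : ℤ) - i₀).natAbs : ℝ)) := by
  intro ω₂ lam β γ hω hl hβ hγ T hT τ hτ
  obtain ⟨C, hC0, hC⟩ := pinnedChain_stationary_site_tails ω₂ lam β γ hω hl hβ hγ T hT
  refine ⟨12 * (4 ^ 16 * C * (1 + τ ^ 32)), by positivity, fun N i₀ ρ hρ => ?_⟩
  exact ⟨_, measurableSet_exc hω hl hβ hγ i₀, measure_exc_le i₀ hτ hρ hC0 hC,
    fun q hq => box_of_not_mem_exc hω hl hβ hγ i₀ hτ hq⟩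

end Summit.AtomisticToContinuum.FouriersLaw.Theorems.AbelThermodynamicLimit.SeriesLawAtEveryLaplaceFrequency

end
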